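import Literature.Probability.Percolation.ArmSeparationGlue
import Literature.Probability.Percolation.LocallyMonotoneFKG
import HarnessLib

/-!
# Quasi-multiplicativity of the two-arm probability from arm separation (Nolin 2008, Prop. 17)

Topic: Probability / Percolation; family `crit-perc`. This file PROVES the implication
`Literature.Probability.Percolation.Nolin2008_twoArm_separation → Literature.Probability.Percolation.Nolin2008_twoArm_quasiMult`
(`Nolin2008_twoArm_quasiMult_of_separation`), i.e. Nolin's deduction of the
quasi-multiplicativity of the polychromatic two-arm probability
`b(n, N) = P_{1/2}(armEvent ![true, false] n N)` (Nolin, *Near-critical percolation in two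
dimensions*, EJP 13 (2008), Prop. 17 [arXiv 0711.4948: Prop. 16]) from his arm-separation
theorem (Thm. 11 [arXiv Thm. 10], vendored for `j = 2` as the named fact
`Nolin2008_twoArm_separation` of `ArmSeparation.lean`) through Prop. 12 [arXiv Prop. 11]
(gluing of well-separated events: generalised FKG for locally monotone events, Lemma 13
[arXiv Lemma 12], PROVED in the tree as `triSitePercolation_locallyMonotone_fkg`, and RSW). With
`twoArm_exponent_of_facts` (`ArmExponentsTwoArm.lean`) the trust base of
`Literature.Probability.Percolation.twoArm_exponent` (Smirnov–Werner 2001, plane exponents, `j = 2`)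
becomes `{SmirnovWerner2001_twoArm_scalingLimit, Nolin2008_twoArm_separation}`
(`twoArm_exponent_of_scalingLimit_of_separation`). Everything in this file is proved; it
introduces no definitions.

## Contents

* `negFlip` preserves `P_{1/2}` (`triSitePercolation_real_preimage_negFlip`), maps local events to
  local events (`DeterminedBy.preimage_negFlip`) and increasing events to decreasing ones
  (`IsUpperSet.preimage_negFlip`).
* Locality and monotonicity of the fenced open arm (`isUpperSet_sepOpenArm`,
  `determinedBy_sepOpenArm`: determined by `sepSupportSet n N`) and of the gluing event
  (`isUpperSet_sepGlue`, `determinedBy_sepGlue`).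
* `exists_le_real_sepGlue` — **RSW**: `P_{1/2}(sepGlue q) ≥ c₀ ^ 69` for all `q ≥ 1`, `c₀` the
  box-crossing constant of `tri_rsw_half_holds` at aspect ratio `98` (Harris chain
  `sitePercolation_real_biInter_ge_prod`, `sitePercolation_harris'`).
* `sep_mul_sep_mul_glue_sq_le_critTwoArmProb` — **the gluing inequality**
  `P(Ã̃(n₁, 64q)) P(Ã̃(512(q+1), n₃)) P(sepGlue q)² ≤ b(n₁, n₃)`: Nolin's Lemma 13 with the
  shared region `Λ_{64q} ∪ {512(q+1) ≤ |·|_𝕋 ≤ n₃ + n₃/8}`, the right and left halves of the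
  middle annulus, independence of the two well-separated events (disjoint supports,
  `sitePercolation_real_inter_of_disjoint`) and the deterministic gluing
  `sepTwoArm_inter_sepGlue_subset` (`ArmSeparationGlue.lean`).
* `critTwoArmProb_quasiMult_spaced` — quasi-multiplicativity for `2n₁ + 64 ≤ n₂`,
  `16 n₂ + 1024 ≤ n₃` (with `q = ⌊n₂/64⌋` and monotonicity of `b` in both radii);
  `Nolin2008_twoArm_quasiMult_of_separation` — the general case, the bounded-ratio cases being
  settled by the RSW a-priori bound `c (n/N)^ζ ≤ b(n, N)` (`exists_rpow_le_critTwoArmProb`,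
  `ArmEventsAPriori.lean`; Nolin Prop. 14 [arXiv Prop. 13]) — "we may assume that `n₂ ≥ 8 n₁`"
  in Nolin's proof.
* `twoArm_exponent_of_scalingLimit_of_separation` — the two-arm exponent from Smirnov–Werner's
  scaling-limit input and Nolin's separation theorem.

## Faithfulness

Nolin's Prop. 17 is uniform in `p` near `1/2` below the characteristic length and for general
`j`, `σ`; only `p = 1/2`, `j = 2`, `σ = BW` is treated (as recorded by the named facts). The
numerical thresholds (`64`, `1024`, `2112`, aspect ratio `98`) are artefacts of the explicit
boxes of `sepGlue` and only affect the constant `c` and the threshold `n₀` of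
`Nolin2008_twoArm_quasiMult`, which that fact leaves unspecified.

## References

* P. Nolin, *Near-critical percolation in two dimensions*, Electron. J. Probab. 13 (2008),
  1562–1623, §4.3 (Prop. 12, Lemma 13, Prop. 14), §4.5 (Prop. 17) [arXiv 0711.4948: Prop. 11,
  Lemma 12, Prop. 13, Prop. 16; EJP number = arXiv number + 1, see `ArmExponentsTwoArm.lean`].
  [Nolin2008]
* S. Smirnov, W. Werner, *Critical exponents for two-dimensional percolation*, Math. Res. Lett. 8
  (2001), 729–744, §4 (10) and §4.2 (approximate multiplicativity), Rem. 2 (colour exchange).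
  [SmirnovWernerMRL2001]
* H. Kesten, *Scaling relations for 2D-percolation*, Comm. Math. Phys. 109 (1987), 109–156.
  [Kesten1987]

Mathlib search: no percolation / arm events / RSW in Mathlib; used from Mathlib: `Real.rpow`
monotonicity (`Real.rpow_le_rpow`, `Real.rpow_le_one`), `Finset` algebra, `IsUpperSet.inter`.
Tree: `ArmSeparationGlue.lean`, `ArmSeparation.lean`, `LocallyMonotoneFKG.lean`
(`triSitePercolation_locallyMonotone_fkg`), `ArmEventsAPriori.lean`
(`exists_rpow_le_critTwoArmProb`, `triSitePercolation_real_preimage_relabel_neg_compl`,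
`determinedBy_preimage_relabel_neg_compl`), `ArmEventsProofs.lean` (`polyArmProb_anti_holds`,
`armEvent_mono_left`, `polyArmProb_nonneg`, `polyArmProb_le_one`), `ArmExponentsTwoArm.lean`
(`critTwoArmProb`, the two named facts, `twoArm_exponent_of_facts`), `TriRSWChaining.lean`,
`TriThetaHalf.lean` (`tri_rsw_half_holds`), `SiteHarrisChain.lean`, `SitePercolationMeasure.lean`.
-/

noncomputable section

open MeasureTheory Set

namespace Literature.Probability.Percolation

open LatticeModels

/-! ### `negFlip`: measure preservation, locality, monotonicity -/

/-- `negFlip` (central symmetry composed with colour exchange) preserves `P_{1/2}`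
(lattice symmetry and self-duality of `p = 1/2`; Smirnov–Werner 2001, Rem. 2). [cite: SmirnovWernerMRL2001, Rem. 2] -/
theorem triSitePercolation_real_preimage_negFlip (E : Set (SiteConfig (Site 2))) :
    (triSitePercolation half).real (negFlip ⁻¹' E) = (triSitePercolation half).real E := by
  rw [negFlip_eq]
  exact triSitePercolation_real_preimage_relabel_neg_compl E

/-- The `negFlip`-preimage of an event determined by `S` is determined by `-S`. [folklore] -/
theorem DeterminedBy.preimage_negFlip {E : Set (SiteConfig (Site 2))} {S : Set (Site 2)}
    (hE : DeterminedBy E S) : DeterminedBy (negFlip ⁻¹' E) (Neg.neg ⁻¹' S) := by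
  rw [negFlip_eq]
  exact determinedBy_preimage_relabel_neg_compl hE

/-- `negFlip` is antitone: opening sites of `ω` closes sites of `negFlip ω`. [folklore] -/
theorem negFlip_antitone {ω ω' : SiteConfig (Site 2)} (h : ω ≤ ω') : negFlip ω' ≤ negFlip ω :=
  fun _ hx hx' => hx (h hx')

/-- The `negFlip`-preimage of an increasing event is decreasing. [folklore] -/
theorem IsUpperSet.preimage_negFlip {E : Set (SiteConfig (Site 2))} (hE : IsUpperSet E) :
    IsLowerSet (negFlip ⁻¹' E) :=
  fun _ _ h hmem => hE (negFlip_antitone h) hmem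

/-! ### Locality and monotonicity of the fenced arm events -/

/-- The fenced open arm is an increasing event. [cite: Nolin2008, §4.2, well-separated arm events (arXiv 0711.4948: Def. 6–8)] -/
theorem isUpperSet_sepOpenArm (n N : ℕ) : IsUpperSet (sepOpenArm n N) := by
  rintro ω ω' hle ⟨z, z', u, u', hz, hz', ⟨b, t, hb, ht, p₁, p₂⟩, ⟨b', t', hb', ht', p₃, p₄⟩, p₅⟩
  exact ⟨z, z', u, u', hz, hz',
    ⟨b, t, hb, ht, p₁.mono fun v hv => ⟨hv.1, hle hv.2⟩, p₂.mono fun v hv => ⟨hv.1, hle hv.2⟩⟩,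
    ⟨b', t', hb', ht', p₃.mono fun v hv => ⟨hv.1, hle hv.2⟩, p₄.mono fun v hv => ⟨hv.1, hle hv.2⟩⟩,
    p₅.mono fun v hv => ⟨hv.1, hle hv.2⟩⟩

/-- Restricting a configuration to a superset of `X` does not change the paths inside `X`. [folklore] -/
theorem pathIn_inter_inter_of_subset {X T : Set (Site 2)} {ω : SiteConfig (Site 2)} (hXT : X ⊆ T)
    {x y : Site 2} : PathIn triGraph (X ∩ (ω ∩ T)) x y ↔ PathIn triGraph (X ∩ ω) x y := by
  have : X ∩ (ω ∩ T) = X ∩ ω := by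
    ext v
    exact ⟨fun h => ⟨h.1, h.2.1⟩, fun h => ⟨h.1, h.2, hXT h.1⟩⟩
  rw [this]

/-- The fenced open arm only depends on the sites of its support set: restricting the
configuration to `sepSupportSet n N` does not change the event (`n ≤ N`). [cite: Nolin2008, §4.2, well-separated arm events (arXiv 0711.4948: Def. 6–8)] -/
theorem mem_sepOpenArm_iff_inter {n N : ℕ} (hnN : n ≤ N) (ω : SiteConfig (Site 2)) :
    ω ∈ sepOpenArm n N ↔ ω ∩ sepSupportSet n N ∈ sepOpenArm n N := by
  constructor
  · rintro ⟨z, z', u, u', hz, hz', ⟨b, t, hb, ht, p₁, p₂⟩, ⟨b', t', hb', ht', p₃, p₄⟩, p₅⟩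
    have hI := sepInnerFence_subset_sepSupportSet hnN hz'
    have hO := sepOuterFence_subset_sepSupportSet hnN hz
    have hJ := sepJoinRegion_subset_sepSupportSet hnN hz hz'
    exact ⟨z, z', u, u', hz, hz',
      ⟨b, t, hb, ht, (pathIn_inter_inter_of_subset hI).2 p₁, (pathIn_inter_inter_of_subset hI).2 p₂⟩,
      ⟨b', t', hb', ht', (pathIn_inter_inter_of_subset hO).2 p₃, (pathIn_inter_inter_of_subset hO).2 p₄⟩,
      (pathIn_inter_inter_of_subset hJ).2 p₅⟩
  · intro h
    exact isUpperSet_sepOpenArm n N (show ω ∩ sepSupportSet n N ≤ ω from inter_subset_left) h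

/-- **Locality of the fenced open arm**: `sepOpenArm n N` is determined by the sites of
`sepSupportSet n N` (`n ≤ N`). [cite: Nolin2008, §4.2, well-separated arm events (arXiv 0711.4948: Def. 6–8)] -/
theorem determinedBy_sepOpenArm {n N : ℕ} (hnN : n ≤ N) :
    DeterminedBy (sepOpenArm n N) (sepSupportSet n N) := by
  rw [determinedBy_iff]
  intro ω ω' hω
  rw [mem_sepOpenArm_iff_inter hnN ω, mem_sepOpenArm_iff_inter hnN ω', hω]


/-! ### The gluing event: locality, monotonicity and an RSW lower bound -/

/-- The gluing event is determined by the sites of its boxes. [cite: Nolin2008, §4.3 Prop. 12 (proof) (arXiv 0711.4948: Prop. 11)] -/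
theorem determinedBy_sepGlue (q : ℕ) : DeterminedBy (sepGlue q) ↑(sepGlueFinset q) := by
  classical
  have h1 : DeterminedBy (⋂ k ∈ Finset.range 33, triHCross (64 * (q : ℤ) + 1) ((-48 + (k : ℤ)) * q) (16 * q) q)
      ↑((Finset.range 33).biUnion (fun k => triStripFinset (64 * (q : ℤ) + 1) ((-48 + (k : ℤ)) * q) (16 * q) q)) :=
    DeterminedBy.biInter_finset _ fun k _ => determinedBy_triHCross _ _ _ _
  have h5 : DeterminedBy (⋂ k ∈ Finset.range 33, triHCross (432 * ((q : ℤ) + 1) - 1)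
      ((-48 + (k : ℤ)) * (8 * ((q : ℤ) + 1))) (80 * (q + 1)) (8 * (q + 1)))
      ↑((Finset.range 33).biUnion (fun k => triStripFinset (432 * ((q : ℤ) + 1) - 1)
        ((-48 + (k : ℤ)) * (8 * ((q : ℤ) + 1))) (80 * (q + 1)) (8 * (q + 1)))) :=
    DeterminedBy.biInter_finset _ fun k _ => determinedBy_triHCross _ _ _ _
  have h2 := determinedBy_triVCross (72 * (q : ℤ) + 1) (-(392 * ((q : ℤ) + 1))) (8 * q) (392 * (q + 1))
  have h3 := determinedBy_triHCross (72 * (q : ℤ) + 1) (-(392 * ((q : ℤ) + 1))) (368 * q + 438) (392 * (q + 1))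
  have h4 := determinedBy_triVCross (432 * ((q : ℤ) + 1) - 1) (-(392 * ((q : ℤ) + 1))) (8 * (q + 1)) (392 * (q + 1))
  unfold sepGlue sepGlueFinset
  simp only [Finset.coe_union]
  exact ((((h1.mono (subset_union_left.trans (subset_union_left.trans
      (subset_union_left.trans subset_union_left)))).inter
    (h2.mono (subset_union_right.trans (subset_union_left.trans
      (subset_union_left.trans subset_union_left))))).inter
    (h3.mono (subset_union_right.trans (subset_union_left.trans subset_union_left)))).inter
    (h4.mono (subset_union_right.trans subset_union_left))).inter (h5.mono subset_union_right)

/-- The gluing event is increasing. [cite: Nolin2008, §4.3 Prop. 12 (proof) (arXiv 0711.4948: Prop. 11)] -/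
theorem isUpperSet_sepGlue (q : ℕ) : IsUpperSet (sepGlue q) := by
  rw [sepGlue]
  refine ((((isUpperSet_iInter₂ fun k _ => isUpperSet_triHCross _ _ _ _).inter
    (isUpperSet_triVCross _ _ _ _)).inter (isUpperSet_triHCross _ _ _ _)).inter
    (isUpperSet_triVCross _ _ _ _)).inter (isUpperSet_iInter₂ fun k _ => isUpperSet_triHCross _ _ _ _)

/-- **RSW lower bound for the gluing event.** There is `c > 0` with `P_{1/2}(sepGlue q) ≥ c` for
all `q ≥ 1`: each of the `69` boxes has aspect ratio at most `98`, so is crossed the prescribed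
way with probability at least the RSW constant `c₀` of `tri_rsw_half_holds` at ratio `98`, and the
Harris–FKG inequality (`sitePercolation_real_biInter_ge_prod`, `sitePercolation_harris'`) gives
`c = c₀ ^ 69`. (Nolin 2008, proof of Prop. 12 [arXiv Prop. 11]: "gluing arguments based on RSW
constructions".) [cite: Nolin2008, §4.3 Prop. 12 (proof) (arXiv 0711.4948: Prop. 11)] -/
theorem exists_le_real_sepGlue :
    ∃ c : ℝ, 0 < c ∧ ∀ q : ℕ, 1 ≤ q → c ≤ (triSitePercolation half).real (sepGlue q) := by
  classical
  obtain ⟨c₀, hc₀, hrsw⟩ := tri_rsw_half_holds (98 : ℝ) (by norm_num)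
  have key : ∀ w h : ℕ, 1 ≤ h → w ≤ 98 * h → c₀ ≤ triLRCrossingProb half w h := by
    intro w h hh hw
    have hfl : ⌊(98 : ℝ) * h⌋₊ = 98 * h := by
      have : (98 : ℝ) * h = ((98 * h : ℕ) : ℝ) := by push_cast; ring
      rw [this, Nat.floor_natCast]
    obtain ⟨h1, -⟩ := hrsw h (by rw [hfl]; omega)
    rw [hfl] at h1
    exact h1.trans (triLRCrossingProb_anti_width half hw h)
  refine ⟨c₀ ^ 69, by positivity, fun q hq => ?_⟩
  -- the five groups of crossings
  set H : ℕ → Set (SiteConfig (Site 2)) := fun k =>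
    triHCross (64 * (q : ℤ) + 1) ((-48 + (k : ℤ)) * q) (16 * q) q with hH
  set FH : ℕ → Finset (Site 2) := fun k =>
    triStripFinset (64 * (q : ℤ) + 1) ((-48 + (k : ℤ)) * q) (16 * q) q with hFH
  set H' : ℕ → Set (SiteConfig (Site 2)) := fun k =>
    triHCross (432 * ((q : ℤ) + 1) - 1) ((-48 + (k : ℤ)) * (8 * ((q : ℤ) + 1))) (80 * (q + 1)) (8 * (q + 1)) with hH'
  set FH' : ℕ → Finset (Site 2) := fun k =>
    triStripFinset (432 * ((q : ℤ) + 1) - 1) ((-48 + (k : ℤ)) * (8 * ((q : ℤ) + 1))) (80 * (q + 1)) (8 * (q + 1)) with hFH'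
  set V₁ : Set (SiteConfig (Site 2)) := triVCross (72 * (q : ℤ) + 1) (-(392 * ((q : ℤ) + 1))) (8 * q) (392 * (q + 1)) with hV₁
  set L : Set (SiteConfig (Site 2)) := triHCross (72 * (q : ℤ) + 1) (-(392 * ((q : ℤ) + 1))) (368 * q + 438) (392 * (q + 1)) with hL
  set V₂ : Set (SiteConfig (Site 2)) := triVCross (432 * ((q : ℤ) + 1) - 1) (-(392 * ((q : ℤ) + 1))) (8 * (q + 1)) (392 * (q + 1)) with hV₂
  set IH : Set (SiteConfig (Site 2)) := ⋂ k ∈ Finset.range 33, H k with hIH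
  set IH' : Set (SiteConfig (Site 2)) := ⋂ k ∈ Finset.range 33, H' k with hIH'
  have hG : sepGlue q = IH ∩ V₁ ∩ L ∩ V₂ ∩ IH' := rfl
  -- locality and monotonicity
  have dH : DeterminedBy IH ↑((Finset.range 33).biUnion FH) :=
    DeterminedBy.biInter_finset _ fun k _ => determinedBy_triHCross _ _ _ _
  have dH' : DeterminedBy IH' ↑((Finset.range 33).biUnion FH') :=
    DeterminedBy.biInter_finset _ fun k _ => determinedBy_triHCross _ _ _ _
  have dV₁ := determinedBy_triVCross (72 * (q : ℤ) + 1) (-(392 * ((q : ℤ) + 1))) (8 * q) (392 * (q + 1))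
  have dL := determinedBy_triHCross (72 * (q : ℤ) + 1) (-(392 * ((q : ℤ) + 1))) (368 * q + 438) (392 * (q + 1))
  have dV₂ := determinedBy_triVCross (432 * ((q : ℤ) + 1) - 1) (-(392 * ((q : ℤ) + 1))) (8 * (q + 1)) (392 * (q + 1))
  have uH : IsUpperSet IH := isUpperSet_iInter₂ fun k _ => isUpperSet_triHCross _ _ _ _
  have uH' : IsUpperSet IH' := isUpperSet_iInter₂ fun k _ => isUpperSet_triHCross _ _ _ _
  have uV₁ : IsUpperSet V₁ := isUpperSet_triVCross _ _ _ _
  have uL : IsUpperSet L := isUpperSet_triHCross _ _ _ _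
  have uV₂ : IsUpperSet V₂ := isUpperSet_triVCross _ _ _ _
  -- the individual RSW bounds
  have pH : c₀ ^ 33 ≤ (triSitePercolation half).real IH := by
    have h := sitePercolation_real_biInter_ge_prod half (Finset.range 33) (E := H) (F := FH)
      (fun k _ => determinedBy_triHCross _ _ _ _) (fun k _ => isUpperSet_triHCross _ _ _ _)
    refine le_trans ?_ h
    calc c₀ ^ 33 = ∏ _i ∈ Finset.range 33, c₀ := by simp
      _ ≤ ∏ k ∈ Finset.range 33, (sitePercolation (Site 2) half).real (H k) := by
          refine Finset.prod_le_prod (fun _ _ => hc₀.le) fun k _ => ?_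
          have : (sitePercolation (Site 2) half).real (H k) = triLRCrossingProb half (16 * q) q :=
            triSitePercolation_real_triHCross half _ _ _ _
          rw [this]
          exact key _ _ hq (by omega)
  have pH' : c₀ ^ 33 ≤ (triSitePercolation half).real IH' := by
    have h := sitePercolation_real_biInter_ge_prod half (Finset.range 33) (E := H') (F := FH')
      (fun k _ => determinedBy_triHCross _ _ _ _) (fun k _ => isUpperSet_triHCross _ _ _ _)
    refine le_trans ?_ h
    calc c₀ ^ 33 = ∏ _i ∈ Finset.range 33, c₀ := by simp
      _ ≤ ∏ k ∈ Finset.range 33, (sitePercolation (Site 2) half).real (H' k) := by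
          refine Finset.prod_le_prod (fun _ _ => hc₀.le) fun k _ => ?_
          have : (sitePercolation (Site 2) half).real (H' k) = triLRCrossingProb half (80 * (q + 1)) (8 * (q + 1)) :=
            triSitePercolation_real_triHCross half _ _ _ _
          rw [this]
          exact key _ _ (by omega) (by omega)
  have pV₁ : c₀ ≤ (triSitePercolation half).real V₁ := by
    have : (triSitePercolation half).real V₁ = triLRCrossingProb half (392 * (q + 1)) (8 * q) :=
      triSitePercolation_real_triVCross half _ _ _ _
    rw [this]; exact key _ _ (by omega) (by omega)
  have pL : c₀ ≤ (triSitePercolation half).real L := by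
    have : (triSitePercolation half).real L = triLRCrossingProb half (368 * q + 438) (392 * (q + 1)) :=
      triSitePercolation_real_triHCross half _ _ _ _
    rw [this]; exact key _ _ (by omega) (by omega)
  have pV₂ : c₀ ≤ (triSitePercolation half).real V₂ := by
    have : (triSitePercolation half).real V₂ = triLRCrossingProb half (392 * (q + 1)) (8 * (q + 1)) :=
      triSitePercolation_real_triVCross half _ _ _ _
    rw [this]; exact key _ _ (by omega) (by omega)
  -- Harris
  have d2 : DeterminedBy (IH ∩ V₁) ↑((Finset.range 33).biUnion FH ∪ triStripFinset (72 * (q : ℤ) + 1)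
      (-(392 * ((q : ℤ) + 1))) (8 * q) (392 * (q + 1))) := by
    rw [Finset.coe_union]; exact (dH.mono subset_union_left).inter (dV₁.mono subset_union_right)
  have p2 : c₀ ^ 33 * c₀ ≤ (triSitePercolation half).real (IH ∩ V₁) :=
    (mul_le_mul pH pV₁ hc₀.le measureReal_nonneg).trans (sitePercolation_harris' half dH dV₁ uH uV₁)
  have d3 : DeterminedBy (IH ∩ V₁ ∩ L) ↑((Finset.range 33).biUnion FH ∪ triStripFinset (72 * (q : ℤ) + 1)
      (-(392 * ((q : ℤ) + 1))) (8 * q) (392 * (q + 1)) ∪ triStripFinset (72 * (q : ℤ) + 1)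
      (-(392 * ((q : ℤ) + 1))) (368 * q + 438) (392 * (q + 1))) := by
    rw [Finset.coe_union]; exact (d2.mono subset_union_left).inter (dL.mono subset_union_right)
  have p3 : c₀ ^ 33 * c₀ * c₀ ≤ (triSitePercolation half).real (IH ∩ V₁ ∩ L) :=
    (mul_le_mul p2 pL hc₀.le measureReal_nonneg).trans
      (sitePercolation_harris' half d2 dL (uH.inter uV₁) uL)
  have d4 : DeterminedBy (IH ∩ V₁ ∩ L ∩ V₂) ↑((Finset.range 33).biUnion FH ∪ triStripFinset (72 * (q : ℤ) + 1)
      (-(392 * ((q : ℤ) + 1))) (8 * q) (392 * (q + 1)) ∪ triStripFinset (72 * (q : ℤ) + 1)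
      (-(392 * ((q : ℤ) + 1))) (368 * q + 438) (392 * (q + 1)) ∪ triStripFinset (432 * ((q : ℤ) + 1) - 1)
      (-(392 * ((q : ℤ) + 1))) (8 * (q + 1)) (392 * (q + 1))) := by
    rw [Finset.coe_union]; exact (d3.mono subset_union_left).inter (dV₂.mono subset_union_right)
  have p4 : c₀ ^ 33 * c₀ * c₀ * c₀ ≤ (triSitePercolation half).real (IH ∩ V₁ ∩ L ∩ V₂) :=
    (mul_le_mul p3 pV₂ hc₀.le measureReal_nonneg).trans
      (sitePercolation_harris' half d3 dV₂ ((uH.inter uV₁).inter uL) uV₂)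
  have p5 : c₀ ^ 33 * c₀ * c₀ * c₀ * c₀ ^ 33 ≤ (triSitePercolation half).real (IH ∩ V₁ ∩ L ∩ V₂ ∩ IH') :=
    (mul_le_mul p4 pH' (by positivity) measureReal_nonneg).trans
      (sitePercolation_harris' half d4 dH' (((uH.inter uV₁).inter uL).inter uV₂) uH')
  calc c₀ ^ 69 = c₀ ^ 33 * c₀ * c₀ * c₀ * c₀ ^ 33 := by ring
    _ ≤ (triSitePercolation half).real (sepGlue q) := by rw [hG]; exact p5


/-! ### Gluing the probabilities: locally monotone FKG and independence -/

-- The default recursion depth is exceeded by the `constructorNameAsVariable` linter on this long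
-- proof (many `omega` calls on large contexts); raising it changes nothing else.
set_option maxRecDepth 4096 in
/-- **The gluing inequality** (Nolin 2008, Prop. 12 [arXiv 0711.4948: Prop. 11], item
"quasi-multiplicativity" for well-separated events, `j = 2`, `σ = BW`, at `p = 1/2`, in the
hexagonal annuli at the scales `64q ≤ 512(q+1)`):
`P(Ã̃(n₁, 64q)) · P(Ã̃(512(q+1), n₃)) · P(glue)² ≤ P(A_{2,BW}(n₁, n₃))`.
Proof as printed: the generalised FKG inequality for locally monotone events (Nolin Lemma 13
[arXiv Lemma 12], `triSitePercolation_locallyMonotone_fkg`) with the shared region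
`Λ_{64q} ∪ {512(q+1) ≤ |·|_𝕋}`, the right half `{x₀ > 0}` of the middle annulus (open arms' free
spaces and the open gluing boxes) and its left half (closed ones), independence of the two
well-separated events (disjoint supports), invariance of `P_{1/2}` under `negFlip`, and the
deterministic gluing `sepTwoArm_inter_sepGlue_subset`. [cite: Nolin2008, §4.3 Prop. 12 (arXiv 0711.4948: Prop. 11)] -/
theorem sep_mul_sep_mul_glue_sq_le_critTwoArmProb {q n₁ n₃ : ℕ} (hq : 1 ≤ q) (h₁ : n₁ ≤ 64 * q)
    (h₃ : 512 * (q + 1) ≤ n₃) :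
    (triSitePercolation half).real (sepTwoArm n₁ (64 * q)) *
        (triSitePercolation half).real (sepTwoArm (512 * (q + 1)) n₃) *
        (triSitePercolation half).real (sepGlue q) ^ 2 ≤ critTwoArmProb n₁ n₃ := by
  classical
  -- the three pairwise disjoint regions of Nolin's Lemma 13
  set S : Finset (Site 2) := triBall (64 * q) ∪
    (triBall (n₃ + n₃ / 8)).filter (fun v => 512 * ((q : ℤ) + 1) ≤ triNorm v) with hS
  set P : Finset (Site 2) := (triBall (512 * (q + 1))).filter
    (fun v => (64 * q : ℤ) < triNorm v ∧ triNorm v < 512 * ((q : ℤ) + 1) ∧ 0 < v 0) with hP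
  set M : Finset (Site 2) := (triBall (512 * (q + 1))).filter
    (fun v => (64 * q : ℤ) < triNorm v ∧ triNorm v < 512 * ((q : ℤ) + 1) ∧ v 0 < 0) with hM
  have hSP : Disjoint S P := by
    rw [Finset.disjoint_left]; intro v hvS hvP
    simp only [hS, hP, Finset.mem_union, Finset.mem_filter, mem_triBall_iff] at hvS hvP
    push_cast at hvS hvP; omega
  have hSM : Disjoint S M := by
    rw [Finset.disjoint_left]; intro v hvS hvM
    simp only [hS, hM, Finset.mem_union, Finset.mem_filter, mem_triBall_iff] at hvS hvM
    push_cast at hvS hvM; omega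
  have hPM : Disjoint P M := by
    rw [Finset.disjoint_left]; intro v hvP hvM
    simp only [hP, hM, Finset.mem_filter] at hvP hvM
    omega
  -- supports
  have hT₁ : sepSupportSet n₁ (64 * q) ⊆ ↑S ∪ ↑P := by
    intro v hv
    rw [mem_sepSupportSet] at hv
    simp only [hS, hP, Set.mem_union, Finset.mem_coe, Finset.mem_union, Finset.mem_filter, mem_triBall_iff]
    push_cast at hv ⊢; omega
  have hT₂ : sepSupportSet (512 * (q + 1)) n₃ ⊆ ↑S ∪ ↑P := by
    intro v hv
    rw [mem_sepSupportSet] at hv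
    simp only [hS, hP, Set.mem_union, Finset.mem_coe, Finset.mem_union, Finset.mem_filter, mem_triBall_iff]
    push_cast at hv ⊢; omega
  have hT₁' : Neg.neg ⁻¹' sepSupportSet n₁ (64 * q) ⊆ ↑S ∪ ↑M := by
    intro v hv
    rw [Set.mem_preimage, mem_sepSupportSet, triNorm_neg] at hv
    simp only [Pi.neg_apply] at hv
    simp only [hS, hM, Set.mem_union, Finset.mem_coe, Finset.mem_union, Finset.mem_filter, mem_triBall_iff]
    push_cast at hv ⊢; omega
  have hT₂' : Neg.neg ⁻¹' sepSupportSet (512 * (q + 1)) n₃ ⊆ ↑S ∪ ↑M := by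
    intro v hv
    rw [Set.mem_preimage, mem_sepSupportSet, triNorm_neg] at hv
    simp only [Pi.neg_apply] at hv
    simp only [hS, hM, Set.mem_union, Finset.mem_coe, Finset.mem_union, Finset.mem_filter, mem_triBall_iff]
    push_cast at hv ⊢; omega
  have hGP : (↑(sepGlueFinset q) : Set (Site 2)) ⊆ ↑P := by
    intro v hv
    have h := sepGlueFinset_subset hq (Finset.mem_coe.1 hv)
    simp only [hP, Finset.mem_coe, Finset.mem_filter, mem_triBall_iff]
    omega
  have hGM : Neg.neg ⁻¹' (↑(sepGlueFinset q) : Set (Site 2)) ⊆ ↑M := by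
    intro v hv
    have h := sepGlueFinset_subset hq (Finset.mem_coe.1 (Set.mem_preimage.1 hv))
    rw [triNorm_neg] at h
    simp only [Pi.neg_apply] at h
    simp only [hM, Finset.mem_coe, Finset.mem_filter, mem_triBall_iff]
    omega
  -- locality of the events
  have d₁ := determinedBy_sepOpenArm h₁
  have d₂ := determinedBy_sepOpenArm h₃
  have dG := determinedBy_sepGlue q
  -- Nolin's Lemma 13
  have fkg := triSitePercolation_locallyMonotone_fkg half hSP hSM hPM
    (Ap := sepOpenArm n₁ (64 * q) ∩ sepOpenArm (512 * (q + 1)) n₃)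
    (Am := negFlip ⁻¹' sepOpenArm n₁ (64 * q) ∩ negFlip ⁻¹' sepOpenArm (512 * (q + 1)) n₃)
    (Bp := sepGlue q) (Bm := negFlip ⁻¹' sepGlue q)
    ((isUpperSet_sepOpenArm n₁ (64 * q)).inter (isUpperSet_sepOpenArm (512 * (q + 1)) n₃))
    ((IsUpperSet.preimage_negFlip (isUpperSet_sepOpenArm n₁ (64 * q))).inter
      (IsUpperSet.preimage_negFlip (isUpperSet_sepOpenArm (512 * (q + 1)) n₃)))
    (isUpperSet_sepGlue q) (IsUpperSet.preimage_negFlip (isUpperSet_sepGlue q))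
    ((d₁.mono hT₁).inter (d₂.mono hT₂))
    ((d₁.preimage_negFlip.mono hT₁').inter (d₂.preimage_negFlip.mono hT₂'))
    (dG.mono hGP) (dG.preimage_negFlip.mono hGM)
  have hAA : sepOpenArm n₁ (64 * q) ∩ sepOpenArm (512 * (q + 1)) n₃ ∩
      (negFlip ⁻¹' sepOpenArm n₁ (64 * q) ∩ negFlip ⁻¹' sepOpenArm (512 * (q + 1)) n₃) =
      sepTwoArm n₁ (64 * q) ∩ sepTwoArm (512 * (q + 1)) n₃ :=
    Set.inter_inter_inter_comm _ _ _ _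
  -- independence of the two well-separated events
  have dS₁ : DeterminedBy (sepTwoArm n₁ (64 * q)) ↑(triBall (72 * q)) := by
    refine (d₁.mono ?_).inter (d₁.preimage_negFlip.mono ?_)
    · intro v hv
      rw [mem_sepSupportSet] at hv
      simp only [Finset.mem_coe, mem_triBall_iff]
      push_cast at hv ⊢; omega
    · intro v hv
      rw [Set.mem_preimage, mem_sepSupportSet, triNorm_neg] at hv
      simp only [Finset.mem_coe, mem_triBall_iff]
      push_cast at hv ⊢; omega
  have dS₂ : DeterminedBy (sepTwoArm (512 * (q + 1)) n₃)
      ↑((triBall (n₃ + n₃ / 8)).filter (fun v => 448 * ((q : ℤ) + 1) ≤ triNorm v)) := by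
    refine (d₂.mono ?_).inter (d₂.preimage_negFlip.mono ?_)
    · intro v hv
      rw [mem_sepSupportSet] at hv
      simp only [Finset.mem_coe, Finset.mem_filter, mem_triBall_iff]
      push_cast at hv ⊢; omega
    · intro v hv
      rw [Set.mem_preimage, mem_sepSupportSet, triNorm_neg] at hv
      simp only [Finset.mem_coe, Finset.mem_filter, mem_triBall_iff]
      push_cast at hv ⊢; omega
  have hdisj : Disjoint (triBall (72 * q))
      ((triBall (n₃ + n₃ / 8)).filter (fun v => 448 * ((q : ℤ) + 1) ≤ triNorm v)) := by
    rw [Finset.disjoint_left]; intro v hv hv'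
    simp only [Finset.mem_filter, mem_triBall_iff] at hv hv'
    push_cast at hv hv'; omega
  have hind : (triSitePercolation half).real (sepTwoArm n₁ (64 * q) ∩ sepTwoArm (512 * (q + 1)) n₃) =
      (triSitePercolation half).real (sepTwoArm n₁ (64 * q)) *
        (triSitePercolation half).real (sepTwoArm (512 * (q + 1)) n₃) :=
    sitePercolation_real_inter_of_disjoint half dS₁ dS₂ hdisj
  have hGG := triSitePercolation_real_preimage_negFlip (sepGlue q)
  -- the deterministic gluing
  have h₁₃ : n₁ ≤ n₃ := h₁.trans (le_trans (by omega) h₃)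
  have hsub : sepOpenArm n₁ (64 * q) ∩ sepOpenArm (512 * (q + 1)) n₃ ∩
      (negFlip ⁻¹' sepOpenArm n₁ (64 * q) ∩ negFlip ⁻¹' sepOpenArm (512 * (q + 1)) n₃) ∩
      (sepGlue q ∩ negFlip ⁻¹' sepGlue q) ⊆ armEvent ![true, false] n₁ n₃ := by
    rintro ω ⟨⟨⟨hO₁, hO₂⟩, hC₁, hC₂⟩, hG, hG'⟩
    exact sepTwoArm_inter_sepGlue_subset hq h₁₃ ⟨⟨⟨hO₁, hC₁⟩, hG, hG'⟩, hO₂, hC₂⟩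
  calc (triSitePercolation half).real (sepTwoArm n₁ (64 * q)) *
        (triSitePercolation half).real (sepTwoArm (512 * (q + 1)) n₃) *
        (triSitePercolation half).real (sepGlue q) ^ 2
      = (triSitePercolation half).real (sepOpenArm n₁ (64 * q) ∩ sepOpenArm (512 * (q + 1)) n₃ ∩
          (negFlip ⁻¹' sepOpenArm n₁ (64 * q) ∩ negFlip ⁻¹' sepOpenArm (512 * (q + 1)) n₃)) *
          ((triSitePercolation half).real (sepGlue q) *
            (triSitePercolation half).real (negFlip ⁻¹' sepGlue q)) := by
        rw [hAA, hGG, hind]; ring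
    _ ≤ _ := fkg
    _ ≤ critTwoArmProb n₁ n₃ := measureReal_mono hsub (measure_ne_top _ _)


/-! ### Quasi-multiplicativity from arm separation (Nolin 2008, Prop. 17) -/

/-- The arm probability is non-decreasing in the inner radius (a smaller annulus is easier to
cross; `armEvent_mono_left`). [cite: Nolin2008, §4.1] -/
theorem polyArmProb_mono_left {k : ℕ} (κ : Fin k → Bool) {r r' R : ℕ} (hr : r ≤ r') (hR : r' ≤ R) :
    polyArmProb κ r R ≤ polyArmProb κ r' R :=
  measureReal_mono (armEvent_mono_left κ hr hR) (measure_ne_top _ _)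

/-- **Quasi-multiplicativity along well-spaced scales** (Nolin 2008, proof of Prop. 17
[arXiv 0711.4948: Prop. 16]: "we may assume that `n₂ ≥ 8 n₁` … separation and extendability
allow to use the quasi-multiplicativity for `Ã̃` events"): if the arm-separation lower bound
`Nolin2008_twoArm_separation` holds, then for `n₀ ≤ n₁`, `2 n₁ + 64 ≤ n₂`, `16 n₂ + 1024 ≤ n₃`,
`c · b(n₁, n₂) · b(n₂, n₃) ≤ b(n₁, n₃)`; here `q = ⌊n₂ / 64⌋`, the separated events are taken
across `Λ_{64q} ∖ Λ_{n₁}` and `Λ_{n₃} ∖ Λ_{512(q+1)}` (whose probabilities dominate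
`b(n₁, n₂)`, `b(n₂, n₃)` by monotonicity in the radii) and glued by
`sep_mul_sep_mul_glue_sq_le_critTwoArmProb`. [cite: Nolin2008, Prop. 17 (proof) (arXiv 0711.4948: Prop. 16)] -/
theorem critTwoArmProb_quasiMult_spaced (hsep : Nolin2008_twoArm_separation) :
    ∃ c : ℝ, 0 < c ∧ ∃ n₀ : ℕ, ∀ n₁ n₂ n₃ : ℕ, n₀ ≤ n₁ → 2 * n₁ + 64 ≤ n₂ → 16 * n₂ + 1024 ≤ n₃ →
      c * (critTwoArmProb n₁ n₂ * critTwoArmProb n₂ n₃) ≤ critTwoArmProb n₁ n₃ := by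
  obtain ⟨cs, hcs, ns, hsep⟩ := hsep
  obtain ⟨cg, hcg, hglue⟩ := exists_le_real_sepGlue
  refine ⟨cs ^ 2 * cg ^ 2, by positivity, ns, fun n₁ n₂ n₃ h₁ h₁₂ h₂₃ => ?_⟩
  set q := n₂ / 64 with hq
  have hq1 : 1 ≤ q := by omega
  have hq2 : 64 * q ≤ n₂ := by omega
  have hs₁ := hsep n₁ (64 * q) h₁ (by omega)
  have hs₂ := hsep (512 * (q + 1)) n₃ (by omega) (by linarith)
  have core := sep_mul_sep_mul_glue_sq_le_critTwoArmProb hq1 (by omega : n₁ ≤ 64 * q)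
    (by omega : 512 * (q + 1) ≤ n₃)
  have hg : cg ^ 2 ≤ (triSitePercolation half).real (sepGlue q) ^ 2 :=
    pow_le_pow_left₀ hcg.le (hglue q hq1) 2
  have m₁ : critTwoArmProb n₁ n₂ ≤ critTwoArmProb n₁ (64 * q) := polyArmProb_anti_holds _ (by omega) hq2
  have m₂ : critTwoArmProb n₂ n₃ ≤ critTwoArmProb (512 * (q + 1)) n₃ :=
    polyArmProb_mono_left _ (by omega) (by omega)
  have h0₁ := polyArmProb_nonneg ![true, false] n₁ n₂
  have h0₂ := polyArmProb_nonneg ![true, false] n₂ n₃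
  have h0₃ := polyArmProb_nonneg ![true, false] n₁ (64 * q)
  calc cs ^ 2 * cg ^ 2 * (critTwoArmProb n₁ n₂ * critTwoArmProb n₂ n₃)
      ≤ cs ^ 2 * cg ^ 2 * (critTwoArmProb n₁ (64 * q) * critTwoArmProb (512 * (q + 1)) n₃) :=
        mul_le_mul_of_nonneg_left (mul_le_mul m₁ m₂ h0₂ h0₃) (by positivity)
    _ = (cs * critTwoArmProb n₁ (64 * q)) * (cs * critTwoArmProb (512 * (q + 1)) n₃) * cg ^ 2 := by ring
    _ ≤ (triSitePercolation half).real (sepTwoArm n₁ (64 * q)) *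
        (triSitePercolation half).real (sepTwoArm (512 * (q + 1)) n₃) *
        (triSitePercolation half).real (sepGlue q) ^ 2 :=
        mul_le_mul (mul_le_mul hs₁ hs₂ (mul_nonneg hcs.le (polyArmProb_nonneg _ _ _)) measureReal_nonneg)
          hg (by positivity) (by positivity)
    _ ≤ critTwoArmProb n₁ n₃ := core

/-- **Quasi-multiplicativity of the two-arm probability from arm separation** (Nolin 2008,
Prop. 17 [arXiv 0711.4948: Prop. 16], lower half, `j = 2`, `σ = BW`, `p = 1/2`, deduced from
Thm. 11 [arXiv Thm. 10] as printed there): `Nolin2008_twoArm_separation → Nolin2008_twoArm_quasiMult`.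
The well-spaced case is `critTwoArmProb_quasiMult_spaced`; when two of the three radii are
within bounded ratio ("we may assume that `n₂ ≥ 8 n₁`"), the RSW a-priori lower bound
`c (n/N)^ζ ≤ b(n, N)` (`exists_rpow_le_critTwoArmProb`, Nolin Prop. 14 [arXiv Prop. 13]) and
the monotonicity of `b` in both radii reduce to it or settle the claim directly. [cite: Nolin2008, Prop. 17 (arXiv 0711.4948: Prop. 16)] -/
theorem Nolin2008_twoArm_quasiMult_of_separation (hsep : Nolin2008_twoArm_separation) :
    Nolin2008_twoArm_quasiMult := by
  obtain ⟨c₀, hc₀, n₀, hsp⟩ := critTwoArmProb_quasiMult_spaced hsep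
  obtain ⟨ca, ζ, hca, hζ, hap⟩ := exists_rpow_le_critTwoArmProb
  set r : ℝ := (1 / 2112 : ℝ) ^ ζ with hr
  have hr0 : 0 < r := by positivity
  have hr1 : r ≤ 1 := Real.rpow_le_one (by norm_num) (by norm_num) hζ.le
  set c₁ : ℝ := min c₀ 1 with hc₁
  set ca' : ℝ := min ca 1 with hca'
  have hc₁0 : 0 < c₁ := lt_min hc₀ one_pos
  have hca'0 : 0 < ca' := lt_min hca one_pos
  refine ⟨c₁ * (ca' * r), by positivity, max n₀ 1, fun n₁ n₂ n₃ h₀ h₁₂ h₂₃ => ?_⟩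
  have hn₀ : n₀ ≤ n₁ := le_of_max_le_left h₀
  have hn₁ : 1 ≤ n₁ := le_of_max_le_right h₀
  -- the a-priori bound at bounded ratio
  have key : ∀ m N : ℕ, 1 ≤ m → m ≤ N → N ≤ 2112 * m → ca' * r ≤ critTwoArmProb m N := by
    intro m N hm hmN hN
    have h := hap m N hm hmN
    have hN0 : (0 : ℝ) < N := by exact_mod_cast (show 0 < N by omega)
    have hratio : (1 : ℝ) / 2112 ≤ (m : ℝ) / N := by
      rw [div_le_div_iff₀ (by norm_num) hN0]
      have : (N : ℝ) ≤ 2112 * m := by exact_mod_cast hN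
      linarith
    calc ca' * r ≤ ca * ((m : ℝ) / N) ^ ζ :=
          mul_le_mul (min_le_left _ _) (Real.rpow_le_rpow (by norm_num) hratio hζ.le) hr0.le hca.le
      _ ≤ critTwoArmProb m N := h
  have b₁₂0 := polyArmProb_nonneg ![true, false] n₁ n₂
  have b₂₃0 := polyArmProb_nonneg ![true, false] n₂ n₃
  have b₁₂1 := polyArmProb_le_one ![true, false] n₁ n₂
  have b₂₃1 := polyArmProb_le_one ![true, false] n₂ n₃
  have hcc₀ : c₁ * (ca' * r) ≤ c₀ :=
    calc c₁ * (ca' * r) ≤ c₁ * 1 :=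
          mul_le_mul_of_nonneg_left (mul_le_one₀ (min_le_right _ _) hr0.le hr1) hc₁0.le
      _ ≤ c₀ := by rw [mul_one]; exact min_le_left _ _
  have hcc₁ : c₁ * (ca' * r) ≤ ca' * r :=
    calc c₁ * (ca' * r) ≤ 1 * (ca' * r) := mul_le_mul_of_nonneg_right (min_le_right _ _) (by positivity)
      _ = ca' * r := one_mul _
  have hprod1 : critTwoArmProb n₁ n₂ * critTwoArmProb n₂ n₃ ≤ 1 := mul_le_one₀ b₁₂1 b₂₃0 b₂₃1
  by_cases hA : 2 * n₁ + 64 ≤ n₂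
  · by_cases hB : 16 * n₂ + 1024 ≤ n₃
    · -- well-spaced scales
      calc c₁ * (ca' * r) * (critTwoArmProb n₁ n₂ * critTwoArmProb n₂ n₃)
          ≤ c₀ * (critTwoArmProb n₁ n₂ * critTwoArmProb n₂ n₃) :=
            mul_le_mul_of_nonneg_right hcc₀ (mul_nonneg b₁₂0 b₂₃0)
        _ ≤ critTwoArmProb n₁ n₃ := hsp n₁ n₂ n₃ hn₀ hA hB
    · push Not at hB
      by_cases hC : 32 * n₁ + 2080 ≤ n₃
      · -- move the middle radius down to `m₂ = ⌊(n₃ - 1024)/16⌋ ≤ n₂`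
        set m₂ := (n₃ - 1024) / 16 with hm₂
        have hsp' := hsp n₁ m₂ n₃ hn₀ (by omega) (by omega)
        have e1 : critTwoArmProb n₁ n₂ ≤ critTwoArmProb n₁ m₂ :=
          polyArmProb_anti_holds _ (by omega) (by omega)
        have e2 : ca' * r ≤ critTwoArmProb m₂ n₃ := key m₂ n₃ (by omega) (by omega) (by omega)
        calc c₁ * (ca' * r) * (critTwoArmProb n₁ n₂ * critTwoArmProb n₂ n₃)
            ≤ c₁ * (ca' * r) * critTwoArmProb n₁ n₂ :=
              mul_le_mul_of_nonneg_left (mul_le_of_le_one_right b₁₂0 b₂₃1) (by positivity)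
          _ = c₁ * critTwoArmProb n₁ n₂ * (ca' * r) := by ring
          _ ≤ c₀ * critTwoArmProb n₁ m₂ * critTwoArmProb m₂ n₃ :=
              mul_le_mul (mul_le_mul (min_le_left _ _) e1 b₁₂0 hc₀.le) e2 (by positivity)
                (mul_nonneg hc₀.le (polyArmProb_nonneg _ _ _))
          _ = c₀ * (critTwoArmProb n₁ m₂ * critTwoArmProb m₂ n₃) := by ring
          _ ≤ critTwoArmProb n₁ n₃ := hsp'
      · -- all three radii within bounded ratio of `n₁`
        push Not at hC
        calc c₁ * (ca' * r) * (critTwoArmProb n₁ n₂ * critTwoArmProb n₂ n₃)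
            ≤ c₁ * (ca' * r) := mul_le_of_le_one_right (by positivity) hprod1
          _ ≤ ca' * r := hcc₁
          _ ≤ critTwoArmProb n₁ n₃ := key n₁ n₃ hn₁ (by omega) (by omega)
  · push Not at hA
    by_cases hD : 1056 * n₁ + 1024 ≤ n₃
    · -- move the middle radius up to `66 n₁ ≥ n₂`
      have hsp' := hsp n₁ (66 * n₁) n₃ hn₀ (by omega) (by omega)
      have e1 : ca' * r ≤ critTwoArmProb n₁ (66 * n₁) := key n₁ (66 * n₁) hn₁ (by omega) (by omega)
      have e2 : critTwoArmProb n₂ n₃ ≤ critTwoArmProb (66 * n₁) n₃ :=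
        polyArmProb_mono_left _ (by omega) (by omega)
      calc c₁ * (ca' * r) * (critTwoArmProb n₁ n₂ * critTwoArmProb n₂ n₃)
          ≤ c₁ * (ca' * r) * critTwoArmProb n₂ n₃ :=
            mul_le_mul_of_nonneg_left (mul_le_of_le_one_left b₂₃0 b₁₂1) (by positivity)
        _ = c₁ * (ca' * r) * critTwoArmProb n₂ n₃ := rfl
        _ ≤ c₀ * critTwoArmProb n₁ (66 * n₁) * critTwoArmProb (66 * n₁) n₃ :=
            mul_le_mul (mul_le_mul (min_le_left _ _) e1 (by positivity) hc₀.le) e2 b₂₃0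
              (mul_nonneg hc₀.le (polyArmProb_nonneg _ _ _))
        _ = c₀ * (critTwoArmProb n₁ (66 * n₁) * critTwoArmProb (66 * n₁) n₃) := by ring
        _ ≤ critTwoArmProb n₁ n₃ := hsp'
    · push Not at hD
      calc c₁ * (ca' * r) * (critTwoArmProb n₁ n₂ * critTwoArmProb n₂ n₃)
          ≤ c₁ * (ca' * r) := mul_le_of_le_one_right (by positivity) hprod1
        _ ≤ ca' * r := hcc₁
        _ ≤ critTwoArmProb n₁ n₃ := key n₁ n₃ hn₁ (by omega) (by omega)


/-- **The two-arm exponent from the scaling limit and arm separation.** Smirnov–Werner's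
Thm. 4 (`j = 2`; `twoArm_exponent`) follows from their scaling-limit observation (A)
(`SmirnovWerner2001_twoArm_scalingLimit`: Smirnov's theorem and the `SLE₆` exponent `1/4`) and
Nolin's arm-separation theorem for two arms (`Nolin2008_twoArm_separation`), the
quasi-multiplicativity (B) being now derived from the latter. [cite: SmirnovWernerMRL2001, Thm. 4 (j = 2) and §4.2] [cite: Nolin2008, Prop. 17 (arXiv 0711.4948: Prop. 16)] -/
theorem twoArm_exponent_of_scalingLimit_of_separation (hA : SmirnovWerner2001_twoArm_scalingLimit)
    (hsep : Nolin2008_twoArm_separation) : twoArm_exponent :=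
  twoArm_exponent_of_facts hA (Nolin2008_twoArm_quasiMult_of_separation hsep)

end Literature.Probability.Percolation
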